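import Literature.Geometry.Kaehler.AnalyticSetProjection
import HarnessLib

/-!
# Compact analytic sets are finite; holomorphic maps with isolated fibres are immersive somewhere

(Trunk `Kaehler`, item K6 / D8.) Two local tools of the theory of analytic sets, in the
normed-space language of `Literature/Analysis/Complex/AnalyticCover.lean` (`Literature.Analysis.Complex.SCV.IsZeroSetAt`),
used in the proof of [Chirka1989, §4.5 Lemma] (analyticity of the branch locus of a proper
projection, `Literature/Geometry/Kaehler/AnalyticSetBranchLocus.lean`):

* `Literature.Geometry.Kaehler.SCV.finite_of_isCompact_of_isZeroSetAt` — **a compact analytic subset of `ℂⁿ` is finite**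
  [Chirka1989, §3.3 Prop. 1, p. 32], by the printed induction on `n`: for `n = 1` every point of
  a set cut out by holomorphic equations is isolated or interior (identity theorem), and a compact
  subset of `ℂ` has empty interior-which-is-also-closed; for the induction step the slices over
  `ℂⁿ⁻¹` are finite, so the projection to `ℂⁿ⁻¹` is again compact and analytic (elimination of one
  variable, [Chirka1989, §3.2 Thm.], `Literature.Analysis.Complex.SCV.exists_equations_image_fst`, and compactness), hence
  finite. Consequence used downstream: the fibres of a proper projection of an analytic set are
  finite, so every point is isolated in its fibre.
* `Literature.Geometry.Kaehler.SCV.exists_injective_fderiv_of_isolated` — **a holomorphic map all of whose fibres are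
  discrete is an immersion at some point** (so, between spaces of the same dimension, a local
  biholomorphism somewhere, `Literature.Geometry.Kaehler.SCV.exists_surjective_fderiv_of_isolated`,
  `Literature.Geometry.Kaehler.SCV.exists_map_nhds_eq_of_isolated`). Proof: at a point `u₀`
  where the rank of `dg` is maximal (`= r`), compose `g` with a linear map `L` onto `ℂʳ` which is
  injective on `range dg(u₀)`; then `L ∘ g` is a submersion near `u₀`, its level set through `u₀`
  is a holomorphically parametrised submanifold of dimension `dim ker dg(u₀) > 0`
  (`Literature.Analysis.Complex.SCV.exists_straightening`), and along it `dg` kills every tangent vector (the kernels of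
  `dg` and `d(L ∘ g)` agree near `u₀` by the rank count), so `g` is constant on it and `u₀` is not
  isolated in its fibre. [Chirka1989, §2.7 (rank of a holomorphic map), A2 (rank theorem)] —
  a Sard-free form of "finite holomorphic maps are open at generic points" [folklore].

## References

* E. M. Chirka, *Complex Analytic Sets*, Kluwer (1989), Ch. 1 §2.2 (uniqueness theorem), §2.7,
  §3.2 Thm., §3.3 Prop. 1 (p. 32), A2 [Chirka1989].
-/

open Complex Metric Set Filter Function
open scoped Topology Manifold

namespace Literature.Geometry.Kaehler
namespace SCV

/-! ### Compact sets all of whose points are isolated are finite -/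

section Isolated

variable {X : Type*} [TopologicalSpace X]

/-- A compact set all of whose points are isolated in it is finite. [folklore] -/
theorem finite_of_isCompact_of_eventually_notMem {F : Set X} (hF : IsCompact F)
    (h : ∀ z ∈ F, ∀ᶠ w in 𝓝[≠] z, w ∉ F) : F.Finite := by
  classical
  set U : X → Set X := fun z => {w | w ≠ z → w ∉ F} with hU
  have hUmem : ∀ z ∈ F, U z ∈ 𝓝 z := fun z hz => by
    have := h z hz
    rwa [eventually_nhdsWithin_iff] at this
  obtain ⟨t, -, hcover⟩ := hF.elim_nhds_subcover U hUmem
  refine t.finite_toSet.subset fun w hw => ?_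
  obtain ⟨z, hz, hwz⟩ := mem_iUnion₂.1 (hcover hw)
  by_contra hwt
  have hne : w ≠ z := fun h => hwt (h ▸ hz)
  exact hwz hne hw

end Isolated

/-! ### Compact analytic subsets of `ℂ` are finite -/

section OneVariable

/-- In `ℂ`, a point of a set cut out near it by holomorphic equations is either an isolated point
of the set or an interior point (identity theorem for each equation).
[Chirka, *Complex Analytic Sets*, §2.2] [folklore] -/
theorem _root_.Literature.Analysis.Complex.SCV.IsZeroSetAt.eventually_notMem_or_mem_nhds {F : Set ℂ} {z : ℂ} (h : Literature.Analysis.Complex.SCV.IsZeroSetAt F z) :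
    (∀ᶠ w in 𝓝[≠] z, w ∉ F) ∨ F ∈ 𝓝 z := by
  obtain ⟨U, hU, hzU, N, g, hg, hFU⟩ := h
  by_cases hall : ∀ l : Fin N, (fun w => g w l) =ᶠ[𝓝 z] 0
  · right
    have h0 : ∀ᶠ w in 𝓝 z, g w = 0 :=
      (eventually_all.2 hall).mono fun w hw => funext fun l => hw l
    filter_upwards [h0, hU.mem_nhds hzU] with w hw hwU
    exact (hFU.symm.subset ⟨hwU, hw⟩).1
  · left
    push Not at hall
    obtain ⟨l, hl⟩ := hall
    have han : AnalyticAt ℂ (fun w => g w l) z :=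
      (differentiableOn_pi.1 hg l).analyticAt (hU.mem_nhds hzU)
    rcases han.eventually_eq_zero_or_eventually_ne_zero with h0 | hne
    · exact absurd h0 hl
    · filter_upwards [hne, mem_nhdsWithin_of_mem_nhds (hU.mem_nhds hzU)] with w hw hwU hwF
      exact hw (congrFun (hFU.subset ⟨hwF, hwU⟩).2 l)

/-- **A compact analytic subset of `ℂ` is finite** ([Chirka1989, §3.3 Prop. 1], case `n = 1`,
"the uniqueness theorem"): the interior of such a set `F` is open and closed (a limit of interior
points lies in `F` and is not isolated), not all of `ℂ` (which is not compact), hence empty; so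
every point of `F` is isolated and `F` is finite by compactness.
[cite: Chirka1989, §3.3 Prop. 1, p. 32] -/
theorem finite_of_isCompact_of_isZeroSetAt_complex {F : Set ℂ} (hF : IsCompact F)
    (h : ∀ z ∈ F, Literature.Analysis.Complex.SCV.IsZeroSetAt F z) : F.Finite := by
  have hFc : IsClosed F := hF.isClosed
  -- the interior of `F` is closed
  have hcl : IsClosed (interior F) := by
    refine isClosed_of_closure_subset fun z hz => ?_
    have hzF : z ∈ F := hFc.closure_subset (closure_mono interior_subset hz)
    rcases (h z hzF).eventually_notMem_or_mem_nhds with h1 | h1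
    · exfalso
      rw [eventually_nhdsWithin_iff, Metric.eventually_nhds_iff] at h1
      obtain ⟨ε, hε, hball⟩ := h1
      -- `interior F ∩ ball z ε` is open, nonempty, and contained in `{z}`
      obtain ⟨w, hwB, hwI⟩ : (ball z ε ∩ interior F).Nonempty :=
        mem_closure_iff_nhds.1 hz _ (ball_mem_nhds z hε)
      have hopen : IsOpen (interior F ∩ ball z ε) := isOpen_interior.inter isOpen_ball
      obtain ⟨δ, hδ, hδsub⟩ := Metric.isOpen_iff.1 hopen w ⟨hwI, hwB⟩
      have hwz : w = z := by
        by_contra hne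
        exact hball hwB hne (interior_subset hwI)
      -- the point `w + δ / 2` lies in the open piece but differs from `z`
      have hmem : w + (δ / 2 : ℝ) ∈ ball w δ := by
        rw [mem_ball, dist_eq_norm, add_sub_cancel_left, Complex.norm_real, Real.norm_eq_abs,
          abs_of_pos (half_pos hδ)]
        exact half_lt_self hδ
      obtain ⟨hI', hB'⟩ := hδsub hmem
      have hne : w + (δ / 2 : ℝ) ≠ z := by
        rw [hwz]
        intro heq
        have : ((δ / 2 : ℝ) : ℂ) = 0 := by
          have := congrArg (fun x => x - z) heq
          simpa using this
        have h2 : (δ / 2 : ℝ) = 0 := by exact_mod_cast this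
        linarith
      exact hball hB' hne (interior_subset hI')
    · exact mem_interior_iff_mem_nhds.2 h1
  have hclopen : IsClopen (interior F) := ⟨hcl, isOpen_interior⟩
  rcases isClopen_iff.1 hclopen with h0 | huniv
  · refine finite_of_isCompact_of_eventually_notMem hF fun z hz => ?_
    rcases (h z hz).eventually_notMem_or_mem_nhds with h1 | h1
    · exact h1
    · exfalso
      have : z ∈ interior F := mem_interior_iff_mem_nhds.2 h1
      rw [h0] at this
      exact this
  · exfalso
    have hFu : F = univ := univ_subset_iff.1 (huniv ▸ interior_subset)
    exact noncompact_univ ℂ (hFu ▸ hF)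

end OneVariable

/-! ### Slices and projections of compact analytic sets in `E' × ℂ` -/

section Product

variable {E' : Type*} [NormedAddCommGroup E'] [NormedSpace ℂ E']

/-- The slice `{w | (z', w) ∈ F}` of a set cut out near `(z', t)` is cut out near `t`.
[folklore] -/
theorem _root_.Literature.Analysis.Complex.SCV.IsZeroSetAt.slice {G : Type*} [NormedAddCommGroup G] [NormedSpace ℂ G] {F : Set (E' × G)}
    {z' : E'} {t : G} (h : Literature.Analysis.Complex.SCV.IsZeroSetAt F (z', t)) : Literature.Analysis.Complex.SCV.IsZeroSetAt {w : G | (z', w) ∈ F} t := by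
  obtain ⟨W, hW, hxW, N, f, hf, hFW⟩ := h
  have hc : Continuous fun w : G => ((z', w) : E' × G) := by fun_prop
  refine ⟨{w | (z', w) ∈ W}, hW.preimage hc, hxW, N, fun w => f (z', w),
    hf.comp (by fun_prop) fun w hw => hw, ?_⟩
  ext w
  simp only [mem_inter_iff, mem_setOf_eq, mem_preimage, mem_singleton_iff]
  constructor
  · rintro ⟨hwF, hwW⟩
    exact ⟨hwW, (hFW.subset ⟨hwF, hwW⟩).2⟩
  · rintro ⟨hwW, hfw⟩
    exact ⟨(hFW.symm.subset ⟨hwW, hfw⟩).1, hwW⟩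

/-- A finite union of sets cut out near `x` is cut out near `x`. [folklore] -/
theorem isZeroSetAt_biUnion_finset {E : Type*} [NormedAddCommGroup E] [NormedSpace ℂ E]
    {ι : Type*} (s : Finset ι) {Z : ι → Set E} {x : E} (h : ∀ i ∈ s, Literature.Analysis.Complex.SCV.IsZeroSetAt (Z i) x) :
    Literature.Analysis.Complex.SCV.IsZeroSetAt (⋃ i ∈ s, Z i) x := by
  classical
  induction s using Finset.induction_on with
  | empty =>
    refine Literature.Analysis.Complex.SCV.IsZeroSetAt.of_notMem_closure ?_
    simp
  | insert a s ha ih =>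
    rw [Finset.set_biUnion_insert]
    exact (h a (Finset.mem_insert_self a s)).union
      (ih fun i hi => h i (Finset.mem_insert_of_mem hi))

/-- **The projection of a compact analytic set with finite slices is analytic** (the induction
step of [Chirka1989, §3.3 Prop. 1]). Let `F ⊆ E' × ℂ` be compact and cut out by holomorphic
equations near each of its points, with all slices `{w | (z', w) ∈ F}` finite. Then the
projection `fst (F)` is cut out near every point `z'₀` of `E'`: over the finitely many points of
`F` above `z'₀` use elimination of one variable (`exists_equations_image_fst`) in small boxes, and
note that by compactness every point of `F` over a small ball around `z'₀` lies in one of the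
boxes. [cite: Chirka1989, §3.2 Thm., §3.3 Prop. 1] -/
theorem isZeroSetAt_image_fst_of_isCompact {F : Set (E' × ℂ)} (hF : IsCompact F)
    (h : ∀ x ∈ F, Literature.Analysis.Complex.SCV.IsZeroSetAt F x) (hfin : ∀ z', {w : ℂ | (z', w) ∈ F}.Finite) (z'₀ : E') :
    Literature.Analysis.Complex.SCV.IsZeroSetAt (Prod.fst '' F) z'₀ := by
  classical
  have hFc : IsClosed F := hF.isClosed
  -- equations for the projection of the part of `F` in a box around `(z'₀, t)`, for every `t`
  have key : ∀ t : ℂ, ∃ ε r : ℝ, 0 < ε ∧ 0 < r ∧ ∃ (M : ℕ) (g : E' → (Fin M → ℂ)),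
      DifferentiableOn ℂ g (ball z'₀ ε) ∧
      ∀ z' ∈ ball z'₀ ε, g z' = 0 ↔ ∃ w ∈ ball t r, (z', w) ∈ F := by
    intro t
    have hzs : Literature.Analysis.Complex.SCV.IsZeroSetAt F (z'₀, t) := by
      by_cases ht : (z'₀, t) ∈ F
      · exact h _ ht
      · exact Literature.Analysis.Complex.SCV.IsZeroSetAt.of_notMem_closure (by rwa [hFc.closure_eq])
    obtain ⟨W, hW, hxW, N, f, hf, hFW⟩ := hzs
    -- the fibre is finite, so `t` is isolated in (or not in) it
    have hiso : ∀ᶠ w in 𝓝[≠] t, f (z'₀, w) ≠ 0 := by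
      have hc : Continuous fun w : ℂ => ((z'₀, w) : E' × ℂ) := by fun_prop
      have h1 : ∀ᶠ w in 𝓝 t, (z'₀, w) ∈ W := hc.continuousAt.preimage_mem_nhds (hW.mem_nhds hxW)
      have h2 : ∀ᶠ w in 𝓝 t, w ∉ {w : ℂ | (z'₀, w) ∈ F} \ {t} := by
        have hcl : IsClosed ({w : ℂ | (z'₀, w) ∈ F} \ {t}) :=
          ((hfin z'₀).subset Set.sdiff_subset).isClosed
        exact hcl.isOpen_compl.mem_nhds fun hmem => hmem.2 rfl
      rw [eventually_nhdsWithin_iff]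
      filter_upwards [h1, h2] with w hwW hw hne hf0
      exact hw ⟨(hFW.symm.subset ⟨hwW, hf0⟩).1, hne⟩
    obtain ⟨ε, r, R, hε, hr, hrR, hsub, -, M, g, hg, hiff⟩ :=
      Literature.Analysis.Complex.SCV.exists_equations_image_fst hW hf hxW hiso
    refine ⟨ε, r, hε, hr, M, g, hg, fun z' hz' => ?_⟩
    rw [hiff z' hz']
    constructor
    · rintro ⟨w, hw, hfw⟩
      have hmem : (z', w) ∈ W := hsub (mk_mem_prod hz' (ball_subset_ball hrR.le hw))
      exact ⟨w, hw, (hFW.symm.subset ⟨hmem, hfw⟩).1⟩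
    · rintro ⟨w, hw, hwF⟩
      have hmem : (z', w) ∈ W := hsub (mk_mem_prod hz' (ball_subset_ball hrR.le hw))
      exact ⟨w, hw, (hFW.subset ⟨hwF, hmem⟩).2⟩
  choose ε r hε hr M g hg hiff using key
  -- the finitely many points over `z'₀` and their boxes
  set T : Finset ℂ := (hfin z'₀).toFinset with hT
  have hTmem : ∀ {t : ℂ}, t ∈ T ↔ (z'₀, t) ∈ F := fun {t} => by
    rw [hT, Set.Finite.mem_toFinset]; rfl
  set O : Set (E' × ℂ) := ⋃ t ∈ T, ball z'₀ (ε t) ×ˢ ball t (r t) with hO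
  have hOo : IsOpen O := isOpen_biUnion fun t _ => isOpen_ball.prod isOpen_ball
  -- by compactness, over a small ball around `z'₀` all of `F` lies in the boxes
  have hC : IsCompact (F \ O) := hF.diff hOo
  have hz'₀ : z'₀ ∉ Prod.fst '' (F \ O) := by
    rintro ⟨⟨z', w⟩, ⟨hxF, hxO⟩, rfl⟩
    refine hxO (mem_iUnion₂.2 ⟨w, hTmem.2 hxF, ?_⟩)
    exact mk_mem_prod (mem_ball_self (hε w)) (mem_ball_self (hr w))
  obtain ⟨δ, hδ, hδsub⟩ : ∃ δ > 0, ball z'₀ δ ⊆ (Prod.fst '' (F \ O))ᶜ :=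
    Metric.isOpen_iff.1 (hC.image continuous_fst).isClosed.isOpen_compl z'₀ hz'₀
  -- the neighbourhood of `z'₀` and the equations
  set U : Set E' := ball z'₀ δ ∩ ⋂ t ∈ T, ball z'₀ (ε t) with hU
  have hUo : IsOpen U := isOpen_ball.inter (isOpen_biInter_finset fun t _ => isOpen_ball)
  have hz'₀U : z'₀ ∈ U := ⟨mem_ball_self hδ, mem_iInter₂.2 fun t _ => mem_ball_self (hε t)⟩
  have hpieces : Literature.Analysis.Complex.SCV.IsZeroSetAt (⋃ t ∈ T, {z' ∈ ball z'₀ (ε t) | g t z' = 0}) z'₀ := by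
    refine isZeroSetAt_biUnion_finset T fun t _ => ?_
    refine ⟨ball z'₀ (ε t), isOpen_ball, mem_ball_self (hε t), M t, g t, hg t, ?_⟩
    ext z'
    simp only [mem_inter_iff, mem_setOf_eq, mem_preimage, mem_singleton_iff]
    tauto
  refine hpieces.congr hUo hz'₀U ?_
  ext z'
  constructor
  · rintro ⟨hz', hz'U⟩
    obtain ⟨t, ht, hz'ball, hgz⟩ : ∃ t ∈ T, z' ∈ ball z'₀ (ε t) ∧ g t z' = 0 := by
      simpa only [mem_iUnion, mem_setOf_eq, exists_prop] using hz'
    obtain ⟨w, -, hwF⟩ := (hiff t z' hz'ball).1 hgz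
    exact ⟨⟨(z', w), hwF, rfl⟩, hz'U⟩
  · rintro ⟨⟨⟨z'', w⟩, hxF, hxz⟩, hz'U⟩
    simp only at hxz
    subst hxz
    refine ⟨?_, hz'U⟩
    -- `(z'', w) ∈ O`
    have hxO : (z'', w) ∈ O := by
      by_contra hxO
      exact hδsub hz'U.1 ⟨(z'', w), ⟨hxF, hxO⟩, rfl⟩
    obtain ⟨t, ht, hbox⟩ := mem_iUnion₂.1 hxO
    have hgz : g t z'' = 0 := (hiff t z'' hbox.1).2 ⟨w, hbox.2, hxF⟩
    simp only [mem_iUnion, mem_setOf_eq, exists_prop]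
    exact ⟨t, ht, hbox.1, hgz⟩

end Product

/-! ### Compact analytic sets are finite -/

section Finite

/-- **Compact analytic subsets of `ℂⁿ` are finite** ([Chirka1989, §3.3 Prop. 1]), coordinate
form, by induction on `n`: the slices over `ℂⁿ⁻¹` are compact analytic subsets of `ℂ`, hence
finite; so the projection to `ℂⁿ⁻¹` is compact and analytic
(`isZeroSetAt_image_fst_of_isCompact`), hence finite by induction, and `F` lies in a finite
union of finite slices. [cite: Chirka1989, §3.3 Prop. 1, p. 32] -/
theorem finite_of_isCompact_of_isZeroSetAt_pi (n : ℕ) : ∀ {F : Set (Fin n → ℂ)}, IsCompact F →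
    (∀ x ∈ F, Literature.Analysis.Complex.SCV.IsZeroSetAt F x) → F.Finite := by
  induction n with
  | zero => intro F _ _; exact Set.toFinite F
  | succ n ih =>
    intro F hF h
    have hdim : Module.finrank ℂ (Fin (n + 1) → ℂ) = Module.finrank ℂ ((Fin n → ℂ) × ℂ) := by
      simp
    set Θ : (Fin (n + 1) → ℂ) ≃L[ℂ] (Fin n → ℂ) × ℂ := ContinuousLinearEquiv.ofFinrankEq hdim
      with hΘ
    set F' : Set ((Fin n → ℂ) × ℂ) := Θ '' F with hF'
    have hF'c : IsCompact F' := hF.image Θ.continuous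
    have h' : ∀ x ∈ F', Literature.Analysis.Complex.SCV.IsZeroSetAt F' x := by
      rintro _ ⟨x, hx, rfl⟩
      exact (h x hx).image_equiv Θ
    -- the slices are finite
    have hsl : ∀ z' : Fin n → ℂ, {w : ℂ | (z', w) ∈ F'}.Finite := fun z' => by
      refine finite_of_isCompact_of_isZeroSetAt_complex ?_ fun w hw => (h' _ hw).slice
      have heq : {w : ℂ | (z', w) ∈ F'} = Prod.snd '' (F' ∩ Prod.fst ⁻¹' {z'}) := by
        ext w
        simp only [mem_setOf_eq, mem_image, mem_inter_iff, mem_preimage, mem_singleton_iff,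
          Prod.exists, exists_eq_right]
      rw [heq]
      exact (hF'c.inter_right (isClosed_singleton.preimage continuous_fst)).image continuous_snd
    -- the projection is finite
    have himg : (Prod.fst '' F').Finite :=
      ih (hF'c.image continuous_fst) fun z' _ =>
        isZeroSetAt_image_fst_of_isCompact hF'c h' hsl z'
    -- conclusion
    have hF'fin : F'.Finite := by
      have hsub : F' ⊆ ⋃ z' ∈ Prod.fst '' F', (fun w => (z', w)) '' {w : ℂ | (z', w) ∈ F'} := by
        rintro ⟨z', w⟩ hx
        exact mem_biUnion (mem_image_of_mem _ hx) ⟨w, hx, rfl⟩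
      exact (himg.biUnion fun z' _ => (hsl z').image _).subset hsub
    exact hF'fin.of_finite_image Θ.injective.injOn

variable {E : Type*} [NormedAddCommGroup E] [NormedSpace ℂ E] [FiniteDimensional ℂ E]

/-- **Compact analytic sets are finite** ([Chirka1989, §3.3 Prop. 1]: *an analytic set
`A ⊆ ℂⁿ` is compact if and only if `A` is a finite set*; the nontrivial direction): a compact
subset `F` of a finite-dimensional complex normed space which is cut out by finitely many
holomorphic equations near each of its points is finite.
[cite: Chirka1989, §3.3 Prop. 1, p. 32] -/
theorem finite_of_isCompact_of_isZeroSetAt {F : Set E} (hF : IsCompact F)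
    (h : ∀ x ∈ F, Literature.Analysis.Complex.SCV.IsZeroSetAt F x) : F.Finite := by
  have hdim : Module.finrank ℂ E = Module.finrank ℂ (Fin (Module.finrank ℂ E) → ℂ) := by simp
  set Θ : E ≃L[ℂ] (Fin (Module.finrank ℂ E) → ℂ) := ContinuousLinearEquiv.ofFinrankEq hdim
  have := finite_of_isCompact_of_isZeroSetAt_pi _ (hF.image Θ.continuous) (by
    rintro _ ⟨x, hx, rfl⟩
    exact (h x hx).image_equiv Θ)
  exact this.of_finite_image Θ.injective.injOn

/-- **Points of compact analytic sets are isolated**: under the hypotheses of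
`finite_of_isCompact_of_isZeroSetAt`, every point of `E` has a punctured neighbourhood missing
`F`. [cite: Chirka1989, §3.3 Prop. 1, p. 32] -/
theorem eventually_notMem_of_isCompact_of_isZeroSetAt {F : Set E} (hF : IsCompact F)
    (h : ∀ x ∈ F, Literature.Analysis.Complex.SCV.IsZeroSetAt F x) (z : E) : ∀ᶠ w in 𝓝[≠] z, w ∉ F := by
  have hfin : (F \ {z}).Finite := (finite_of_isCompact_of_isZeroSetAt hF h).subset Set.sdiff_subset
  have h1 : ∀ᶠ w in 𝓝 z, w ∉ F \ {z} :=
    hfin.isClosed.isOpen_compl.mem_nhds fun hmem => hmem.2 rfl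
  rw [eventually_nhdsWithin_iff]
  filter_upwards [h1] with w hw hne hwF
  exact hw ⟨hwF, hne⟩

end Finite

/-! ### Holomorphic maps with isolated fibres are immersive somewhere -/

section Rank

variable {X : Type*} [NormedAddCommGroup X] [NormedSpace ℂ X] [FiniteDimensional ℂ X]
  {F : Type*} [NormedAddCommGroup F] [NormedSpace ℂ F] [FiniteDimensional ℂ F]

/-- For a linear map `T : X → F` with range of dimension `r` there is a linear map `L : F → ℂʳ`
with `L ∘ T` onto (coordinates on `range T` after projecting along a complement). [folklore] -/
theorem exists_comp_surjective (T : X →L[ℂ] F) :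
    ∃ L : F →L[ℂ] (Fin (Module.finrank ℂ (LinearMap.range (T : X →ₗ[ℂ] F))) → ℂ),
      Function.Surjective (L.comp T) := by
  set R : Submodule ℂ F := LinearMap.range (T : X →ₗ[ℂ] F) with hR
  obtain ⟨C, hRC⟩ := R.exists_isCompl
  set P : F →ₗ[ℂ] R := R.projectionOnto C hRC with hP
  have hfin : Module.finrank ℂ R = Module.finrank ℂ (Fin (Module.finrank ℂ R) → ℂ) := by simp
  set e : R ≃ₗ[ℂ] (Fin (Module.finrank ℂ R) → ℂ) := LinearEquiv.ofFinrankEq R _ hfin with he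
  refine ⟨LinearMap.toContinuousLinearMap ((e : R →ₗ[ℂ] _) ∘ₗ P), fun t => ?_⟩
  obtain ⟨v, hv⟩ : ((e.symm t : R) : F) ∈ R := (e.symm t).2
  refine ⟨v, ?_⟩
  have hPx : P ((e.symm t : R) : F) = e.symm t := Submodule.projectionOnto_apply_left hRC _
  simp only [ContinuousLinearMap.coe_comp, Function.comp_apply, LinearMap.coe_toContinuousLinearMap',
    LinearMap.coe_comp, LinearEquiv.coe_coe]
  rw [show (T v : F) = ((e.symm t : R) : F) from hv, hPx, LinearEquiv.apply_symm_apply]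

/-- **A holomorphic map with isolated fibres is an immersion somewhere.** Let `g : X → F` be
complex-differentiable on a nonempty open set `O` (finite-dimensional spaces) and suppose every
`u ∈ O` is isolated in its fibre `g⁻¹(g u)`. Then `dg(u)` is injective for some `u ∈ O`.
Proof: take `u₀ ∈ O` where `rank dg` is maximal (`= r`); if `dg(u₀)` were not injective, pick
`L : F → ℂʳ` with `L ∘ dg(u₀)` onto; `h = L ∘ g` is a submersion on a neighbourhood `S` of `u₀`
(`exists_straightening`) on which `ker dg = ker dh` (one inclusion is clear, and
`dim ker dg = dim X - rank dg ≥ dim X - r = dim ker dh`); the level set of `h` through `u₀` is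
parametrised by a holomorphic `φ` on a ball of the nontrivial space `ker dh(u₀)` with
`φ 0 = u₀`, `φ k ≠ u₀` for `k ≠ 0`; differentiating `h ∘ φ = const` gives `range dφ ⊆ ker dh =
ker dg`, so `d(g ∘ φ) = 0`, `g ∘ φ` is constant, and `u₀` is not isolated in its fibre.
[Chirka, *Complex Analytic Sets*, §2.7 (rank of a holomorphic map), A2] [folklore] -/
theorem exists_injective_fderiv_of_isolated {O : Set X} (hO : IsOpen O) (hne : O.Nonempty)
    {g : X → F} (hg : DifferentiableOn ℂ g O)
    (hiso : ∀ u ∈ O, ∀ᶠ v in 𝓝[≠] u, g v ≠ g u) :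
    ∃ u ∈ O, Function.Injective (fderiv ℂ g u) := by
  classical
  -- a point of maximal rank
  set ρ : X → ℕ := fun u => Module.finrank ℂ (LinearMap.range (fderiv ℂ g u : X →ₗ[ℂ] F))
    with hρ
  obtain ⟨u₀, hu₀, hmax⟩ : ∃ u₀ ∈ O, ∀ u ∈ O, ρ u ≤ ρ u₀ := by
    have hne' : (ρ '' O).Nonempty := hne.image ρ
    have hb : BddAbove (ρ '' O) :=
      ⟨Module.finrank ℂ F, by rintro _ ⟨u, -, rfl⟩; exact Submodule.finrank_le _⟩
    obtain ⟨u₀, hu₀, hu₀eq⟩ : sSup (ρ '' O) ∈ ρ '' O := Nat.sSup_mem hne' hb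
    exact ⟨u₀, hu₀, fun u hu => hu₀eq ▸ le_csSup hb (mem_image_of_mem ρ hu)⟩
  refine ⟨u₀, hu₀, ?_⟩
  by_contra hninj
  have hker0 : LinearMap.ker (fderiv ℂ g u₀ : X →ₗ[ℂ] F) ≠ ⊥ := by
    rw [Ne, LinearMap.ker_eq_bot]
    exact hninj
  -- `L` and the submersion `h = L ∘ g`
  obtain ⟨L, hL⟩ := exists_comp_surjective (fderiv ℂ g u₀)
  set r : ℕ := ρ u₀ with hr
  set h : X → (Fin r → ℂ) := fun u => L (g u) with hh_def
  have hh : DifferentiableOn ℂ h O := L.differentiable.comp_differentiableOn hg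
  have hhd : ∀ u ∈ O, fderiv ℂ h u = L.comp (fderiv ℂ g u) := fun u hu =>
    (L.hasFDerivAt.comp u (hg.differentiableAt (hO.mem_nhds hu)).hasFDerivAt).fderiv
  have hsurj₀ : Function.Surjective (fderiv ℂ h u₀) := by
    rw [hhd u₀ hu₀]; exact hL
  -- straightening of `h` at `u₀`; `K` is the kernel of `dh(u₀)`
  set K : Submodule ℂ X := LinearMap.ker (fderiv ℂ h u₀ : X →ₗ[ℂ] (Fin r → ℂ)) with hK
  obtain ⟨ψ, hbij⟩ := Literature.Analysis.Complex.SCV.exists_proj_ker_bijective (fderiv ℂ h u₀) hsurj₀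
  obtain ⟨S, T, Ψ, hSo, hu₀S, hSO, hTo, hΨ, hST, hTS, hSsurj⟩ :=
    Literature.Analysis.Complex.SCV.exists_straightening hh hO hu₀ ψ hbij
  -- on `S` the kernels of `dg` and `dh` agree
  have hker : ∀ z ∈ S, LinearMap.ker (fderiv ℂ g z : X →ₗ[ℂ] F) =
      LinearMap.ker (fderiv ℂ h z : X →ₗ[ℂ] (Fin r → ℂ)) := by
    intro z hz
    have hzO : z ∈ O := hSO hz
    have hsz : Function.Surjective (fderiv ℂ h z) := fun t => by
      obtain ⟨v, hv⟩ := hSsurj z hz (t, 0)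
      exact ⟨v, congrArg Prod.fst hv⟩
    apply Submodule.eq_of_le_of_finrank_le
    · intro v hv
      rw [LinearMap.mem_ker, ContinuousLinearMap.coe_coe] at hv ⊢
      rw [hhd z hzO, ContinuousLinearMap.coe_comp, Function.comp_apply, hv, map_zero]
    · have h1 := finrank_ker_of_surjective (fderiv ℂ h z : X →ₗ[ℂ] (Fin r → ℂ)) hsz
      have h2 := LinearMap.finrank_range_add_finrank_ker (fderiv ℂ g z : X →ₗ[ℂ] F)
      have h3 : ρ z ≤ r := hmax z hzO
      simp only [hρ] at h3
      omega
  -- the kernel `K` of `dh(u₀)` is nontrivial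
  haveI hKnt : Nontrivial K := by
    rw [Submodule.nontrivial_iff_ne_bot]
    intro hKbot
    apply hker0
    rw [hker u₀ hu₀S]
    exact hKbot
  -- the holomorphic curve `φ` in the level set of `h` through `u₀`
  set c : Fin r → ℂ := h u₀ with hc
  have hcT : ((c, (0 : K)) : (Fin r → ℂ) × K) ∈ T := by
    have := (hST u₀ hu₀S).1
    simpa [hc, sub_self] using this
  set TK : Set K := {k | ((c, k) : (Fin r → ℂ) × K) ∈ T} with hTK
  have hι : Continuous fun k : K => ((c, k) : (Fin r → ℂ) × K) := continuous_const.prodMk continuous_id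
  have hTKo : IsOpen TK := hTo.preimage hι
  obtain ⟨δ, hδ, hballTK⟩ := Metric.isOpen_iff.1 hTKo 0 hcT
  set φ : K → X := fun k => Ψ (c, k) with hφ
  have hφS : ∀ k ∈ ball (0 : K) δ, φ k ∈ S := fun k hk => (hTS _ (hballTK hk)).1
  have hφh : ∀ k ∈ ball (0 : K) δ, h (φ k) = c := fun k hk =>
    congrArg Prod.fst (hTS _ (hballTK hk)).2
  have hφψ : ∀ k ∈ ball (0 : K) δ, ψ (φ k - u₀) = k := fun k hk =>
    congrArg Prod.snd (hTS _ (hballTK hk)).2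
  have hφ0 : φ 0 = u₀ := by
    have := (hST u₀ hu₀S).2
    simpa [hφ, hc, sub_self] using this
  have hφd : DifferentiableOn ℂ φ (ball (0 : K) δ) :=
    hΨ.comp (by fun_prop) fun k hk => hballTK hk
  -- `g ∘ φ` has zero derivative on the ball
  have hzero : ∀ k ∈ ball (0 : K) δ, HasFDerivAt (g ∘ φ) (0 : K →L[ℂ] F) k := by
    intro k hk
    have hφ' : HasFDerivAt φ (fderiv ℂ φ k) k :=
      (hφd.differentiableAt (isOpen_ball.mem_nhds hk)).hasFDerivAt
    have hzS : φ k ∈ S := hφS k hk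
    have hzO : φ k ∈ O := hSO hzS
    have hg' : HasFDerivAt g (fderiv ℂ g (φ k)) (φ k) :=
      (hg.differentiableAt (hO.mem_nhds hzO)).hasFDerivAt
    have hh' : HasFDerivAt h (fderiv ℂ h (φ k)) (φ k) :=
      (hh.differentiableAt (hO.mem_nhds hzO)).hasFDerivAt
    have hcomp : HasFDerivAt (h ∘ φ) ((fderiv ℂ h (φ k)).comp (fderiv ℂ φ k)) k :=
      hh'.comp k hφ'
    have hconst : HasFDerivAt (h ∘ φ) (0 : K →L[ℂ] (Fin r → ℂ)) k := by
      refine (hasFDerivAt_const c k).congr_of_eventuallyEq ?_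
      filter_upwards [isOpen_ball.mem_nhds hk] with k' hk'
      exact hφh k' hk'
    have heq : (fderiv ℂ h (φ k)).comp (fderiv ℂ φ k) = 0 := hcomp.unique hconst
    have hcomp0 : (fderiv ℂ g (φ k)).comp (fderiv ℂ φ k) = 0 := by
      ext v
      have hv : fderiv ℂ φ k v ∈ LinearMap.ker (fderiv ℂ h (φ k) : X →ₗ[ℂ] (Fin r → ℂ)) := by
        rw [LinearMap.mem_ker, ContinuousLinearMap.coe_coe]
        have := congrArg (fun T : K →L[ℂ] (Fin r → ℂ) => T v) heq
        simpa using this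
      rw [← hker (φ k) hzS, LinearMap.mem_ker, ContinuousLinearMap.coe_coe] at hv
      simpa using hv
    have := hg'.comp k hφ'
    rwa [hcomp0] at this
  -- hence `g ∘ φ` is constant on the ball
  have hgφ : ∀ k ∈ ball (0 : K) δ, g (φ k) = g u₀ := by
    intro k hk
    have hdiff : DifferentiableOn ℂ (g ∘ φ) (ball (0 : K) δ) := fun k' hk' =>
      (hzero k' hk').differentiableAt.differentiableWithinAt
    have := (convex_ball (0 : K) δ).is_const_of_fderivWithin_eq_zero hdiff ?_ hk
      (mem_ball_self hδ)
    · simpa [hφ0] using this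
    · intro k' hk'
      rw [fderivWithin_of_isOpen isOpen_ball hk']
      exact (hzero k' hk').fderiv
  -- but `φ k ≠ u₀` for `k ≠ 0`, `φ k → u₀`: `u₀` is not isolated in its fibre
  have hφne : ∀ k ∈ ball (0 : K) δ, k ≠ 0 → φ k ≠ u₀ := by
    intro k hk hk0 heq
    apply hk0
    have := hφψ k hk
    rw [heq, sub_self, map_zero] at this
    exact this.symm
  have hφc : ContinuousAt φ 0 := (hφd.differentiableAt (ball_mem_nhds _ hδ)).continuousAt
  have hball : ∀ᶠ k in 𝓝[≠] (0 : K), k ∈ ball (0 : K) δ ∧ k ≠ 0 := by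
    rw [eventually_nhdsWithin_iff]
    filter_upwards [ball_mem_nhds (0 : K) hδ] with k hk hk0
    exact ⟨hk, hk0⟩
  have htend : Tendsto φ (𝓝[≠] (0 : K)) (𝓝[≠] u₀) := by
    refine tendsto_nhdsWithin_of_tendsto_nhds_of_eventually_within _ ?_
      (hball.mono fun k hk => hφne k hk.1 hk.2)
    have : Tendsto φ (𝓝 (0 : K)) (𝓝 u₀) := by
      have := hφc.tendsto
      rwa [hφ0] at this
    exact this.mono_left nhdsWithin_le_nhds
  have h1 : ∀ᶠ k in 𝓝[≠] (0 : K), g (φ k) ≠ g u₀ := htend.eventually (hiso u₀ hu₀)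
  have h2 : ∀ᶠ k in 𝓝[≠] (0 : K), g (φ k) = g u₀ := hball.mono fun k hk => hgφ k hk.1
  haveI : (𝓝[≠] (0 : K)).NeBot := Module.punctured_nhds_neBot ℂ K 0
  obtain ⟨k, hk1, hk2⟩ := (h1.and h2).exists
  exact hk1 hk2

/-- **Equidimensional case**: a holomorphic map with isolated fibres between spaces of the same
finite dimension has bijective differential at some point. [folklore] -/
theorem exists_surjective_fderiv_of_isolated (hdim : Module.finrank ℂ X = Module.finrank ℂ F)
    {O : Set X} (hO : IsOpen O) (hne : O.Nonempty) {g : X → F} (hg : DifferentiableOn ℂ g O)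
    (hiso : ∀ u ∈ O, ∀ᶠ v in 𝓝[≠] u, g v ≠ g u) :
    ∃ u ∈ O, Function.Surjective (fderiv ℂ g u) := by
  obtain ⟨u, hu, hinj⟩ := exists_injective_fderiv_of_isolated hO hne hg hiso
  refine ⟨u, hu, ?_⟩
  have := (LinearMap.injective_iff_surjective_of_finrank_eq_finrank hdim
    (f := (fderiv ℂ g u : X →ₗ[ℂ] F))).1 hinj
  exact this

/-- **Equidimensional case, open image**: under the same hypotheses, at some point `u ∈ O` the
map `g` is open at `u`: it maps neighbourhoods of `u` to neighbourhoods of `g u` (inverse function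
theorem, `HasStrictFDerivAt.map_nhds_eq_of_surj`). [folklore] -/
theorem exists_map_nhds_eq_of_isolated (hdim : Module.finrank ℂ X = Module.finrank ℂ F)
    {O : Set X} (hO : IsOpen O) (hne : O.Nonempty) {g : X → F} (hg : DifferentiableOn ℂ g O)
    (hiso : ∀ u ∈ O, ∀ᶠ v in 𝓝[≠] u, g v ≠ g u) :
    ∃ u ∈ O, map g (𝓝 u) = 𝓝 (g u) := by
  haveI : CompleteSpace X := FiniteDimensional.complete ℂ X
  haveI : CompleteSpace F := FiniteDimensional.complete ℂ F
  obtain ⟨u, hu, hsurj⟩ := exists_surjective_fderiv_of_isolated hdim hO hne hg hiso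
  refine ⟨u, hu, ?_⟩
  have hstrict : HasStrictFDerivAt g (fderiv ℂ g u) u :=
    ((Literature.Analysis.Complex.SCV.contDiffOn_one hg hO).contDiffAt (hO.mem_nhds hu)).hasStrictFDerivAt one_ne_zero
  exact hstrict.map_nhds_eq_of_surj (LinearMap.range_eq_top.2 hsurj)

end Rank

end SCV
end Literature.Geometry.Kaehler
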